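import Literature.Geometry.Lorentzian.KerrConvergenceProofs
import Literature.Geometry.Lorentzian.CoordTensorCovariance
import HarnessLib

/-!
# Late charts from a boosted Kerr–Schild background: the chart metric in coordinates

Support file (everything proved; no definition, no named fact) for curvature-based rigidity
arguments about late-time charts `Ψ : U → 𝓢` from a boosted Kerr–Schild background
`B = boostedKerrBackground Λ c M a` (`KerrConvergence.lean`) into a spacetime `𝓢`, in the
coordinate tensor calculus of `CoordCurvature.lean` / `CoordTensorCovariance.lean`
(`MetricCoord.IsMetricOn`, `MetricCoord.pullMetric`, `MetricCoord.IsCoordChangeOn`):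

* `isMetricOn_kerrBilin` — the Kerr–Schild components `Kerr.bilin M a` are metric components on
  the chart domains `Kerr.region a r₀ ⊆ {r > 0}` (Kerr–Schild 1965, §3); `abs_apply_three_le_radius`
  (`|x₃| ≤ r`);
* the boosted background: `boostedKerrBilin_eq_pullMetric` (it is the pull-back of `Kerr.bilin` by
  the affine inverse Poincaré map), `isCoordChangeOn_poincareInv`, `isMetricOn_boostedKerrBilin`,
  and its stationarity along the Killing orbits `s ↦ x + sΛe₀` (`boostedKerrBilin_add_smul`,
  `time_add_smul`, `radius_add_smul`), with the induced invariance of all jets, of `♯`, `Γ`, `R` and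
  `g^{ij}` (`fderiv_eq_of_forall_add_eq`, …, `riemAt_eq_of_forall_add_eq`, `ginv_eq_of_forall_add_eq`);
* the chart metric `Ψ^* g` through a representative `Gp` (`∀ y : U, pullbackBilin Ψ g y = Gp y`):
  smooth components (`contDiffAt_chartMetric`, from `contMDiff_pullbackBilin_holds`, O'Neill 1983,
  Ch. 3, Lemma 3.35), symmetric, metric components where nondegenerate (`isMetricOn_chartMetric`);
* the composite chart `χ ∘ Ψ` into a Kerr–Schild chart when `g = χ^* g_{M,a}` on an open set `E`:
  chain rule (`fderiv_compChart_apply`), **`Ψ^* g = (χ ∘ Ψ)^* (Kerr.bilin M a)` as coordinate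
  components** (`chartMetric_eq_pullMetric`, O'Neill 1983, Ch. 3, p. 58), invertibility of its
  derivative where `Ψ^* g` is nondegenerate, and the open GOOD SET on which it is a change of
  coordinates (`isCoordChangeOn_compChart`);
* the Killing orbit of a background point: the boosted polar-axis point of an extremal background
  (`radius_polar`, `boostedPolar_mem_domain`, `boostedPolar_bilin_neg`), the decay of the `2`-jets of
  the deviation `Ψ^* g − g_B` along the orbit from `truncDeviationCk … 2 R τ → 0`
  (`tendsto_iteratedFDeriv_deviationExtend_orbit`, `tendsto_dev_jets_orbit`, `jets_chartMetric_sub`),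
  and eventual nondegeneracy of `Ψ^* g` along the orbit (`eventually_isInvertible_orbit`).

## References

* R. P. Kerr, A. Schild, *A new class of vacuum solutions of the Einstein field equations* (1965),
  §2–§3 (key `KerrSchild1965`).
* B. O'Neill, *Semi-Riemannian geometry*, Academic Press 1983, Ch. 3, Def. 3.9, Lemma 3.35, p. 58,
  Prop. 3.59 (key `ONeill1983`).
* M. Dafermos, G. Holzegel, I. Rodnianski, M. Taylor, arXiv:2104.08222, §1 (key `arXiv210408222`).
* M. Visser, *The Kerr spacetime: a brief introduction*, arXiv:0706.0622, (35) (key `arXiv07060622`).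
-/

noncomputable section

set_option maxSynthPendingDepth 3

open scoped Manifold ContDiff Topology ENNReal NNReal
open Set Filter Function TopologicalSpace ContinuousLinearMap
open Literature.Geometry.Lorentzian.MetricCoord

namespace Literature.Geometry.Lorentzian

namespace KerrSchildChart


/-! ### The Kerr–Schild components are metric components on `{r > max r₀ 0}` -/

section KerrComponents

/-- An injective continuous linear endomorphism of a finite-dimensional space is invertible.
[folklore] -/
theorem isInvertible_of_injective {E : Type*} [NormedAddCommGroup E] [NormedSpace ℝ E]
    [FiniteDimensional ℝ E] {f : E →L[ℝ] E} (hf : Injective f) : f.IsInvertible := by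
  refine ⟨(LinearEquiv.ofInjectiveEndo (f : E →ₗ[ℝ] E) hf).toContinuousLinearEquiv, ?_⟩
  ext v
  rfl

/-- Metric components restrict to open subsets. [folklore] -/
theorem isMetricOn_mono {E : Type*} [NormedAddCommGroup E] [NormedSpace ℝ E]
    {G : E → E →L[ℝ] E →L[ℝ] ℝ} {V W : Set E} (hG : IsMetricOn G V) (hW : IsOpen W)
    (hWV : W ⊆ V) : IsMetricOn G W where
  isOpen := hW
  contDiffOn := hG.contDiffOn.mono hWV
  symm x hx := hG.symm x (hWV hx)
  isInvertible x hx := hG.isInvertible x (hWV hx)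

/-- **The Kerr–Schild components are metric components on the chart domain `Kerr.region a r₀`**:
smooth (`Kerr.contDiffAt_bilin`), symmetric, nondegenerate on `{r > 0}`. [cite: KerrSchild1965, §3] -/
theorem isMetricOn_kerrBilin (M a r₀ : ℝ) :
    IsMetricOn (Kerr.bilin M a) (Kerr.region a r₀ : Set E4) where
  isOpen := (Kerr.region a r₀).isOpen
  contDiffOn _ hx := (Kerr.contDiffAt_bilin M a (Kerr.radius_pos_of_mem_region hx)).contDiffWithinAt
  symm x _ v w := Kerr.bilin_symm M a x v w
  isInvertible _ hx := isInvertible_of_nondegenerate fun v hv ↦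
    Kerr.bilin_nondegenerate M a (Kerr.radius_pos_of_mem_region hx) v hv

/-- `|x₃| ≤ r`: the Kerr–Schild latitude cosine `x₃/r` lies in `[−1, 1]` (from the defining
quartic `r²(r² + a²) = ρ² r² + a² x₃² ≥ x₃² (r² + a²)`). [cite: arXiv07060622, (35)] -/
theorem abs_apply_three_le_radius {a : ℝ} {x : E4} (hx : 0 < Kerr.radius a x) :
    |x 3| ≤ Kerr.radius a x := by
  have hq := Kerr.radius_quartic a x
  rw [E4.spatialNorm_sq] at hq
  set r := Kerr.radius a x with hr
  have hr0 : 0 ≤ r := hx.le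
  have key : x 3 ^ 2 * (r ^ 2 + a ^ 2) ≤ r ^ 2 * (r ^ 2 + a ^ 2) := by
    nlinarith [sq_nonneg (x 1), sq_nonneg (x 2), sq_nonneg r, sq_nonneg (x 1 * r), sq_nonneg (x 2 * r)]
  have hra : 0 < r ^ 2 + a ^ 2 := by positivity
  have h2 : x 3 ^ 2 ≤ r ^ 2 := le_of_mul_le_mul_right key hra
  exact abs_le_of_sq_le_sq' h2 hr0 |>.elim (fun h1 h2 ↦ abs_le.mpr ⟨h1, h2⟩)

end KerrComponents

/-! ### Second derivative of a difference -/

section JetCalculus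

variable {E F : Type*} [NormedAddCommGroup E] [NormedSpace ℝ E] [NormedAddCommGroup F]
  [NormedSpace ℝ F]

/-- Second derivative of a difference of functions that are smooth on an open set. [folklore] -/
theorem fderiv_fderiv_sub_of_isOpen {f g : E → F} {O : Set E} (hO : IsOpen O)
    (hf : ∀ y ∈ O, ContDiffAt ℝ ∞ f y) (hg : ∀ y ∈ O, ContDiffAt ℝ ∞ g y) {x : E} (hx : x ∈ O) :
    fderiv ℝ (fderiv ℝ (fun y ↦ f y - g y)) x =
      fderiv ℝ (fderiv ℝ f) x - fderiv ℝ (fderiv ℝ g) x := by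
  have hev : fderiv ℝ (fun y ↦ f y - g y) =ᶠ[𝓝 x] fun y ↦ fderiv ℝ f y - fderiv ℝ g y := by
    filter_upwards [hO.mem_nhds hx] with y hy
    exact fderiv_sub ((hf y hy).differentiableAt (by simp)) ((hg y hy).differentiableAt (by simp))
  rw [hev.fderiv_eq]
  have h2le : (1 : ℕ∞ω) + 1 ≤ ((⊤ : ℕ∞) : ℕ∞ω) := WithTop.coe_le_coe.mpr le_top
  have h1 : DifferentiableAt ℝ (fderiv ℝ f) x :=
    ((hf x hx).fderiv_right (m := 1) h2le).differentiableAt one_ne_zero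
  have h2 : DifferentiableAt ℝ (fderiv ℝ g) x :=
    ((hg x hx).fderiv_right (m := 1) h2le).differentiableAt one_ne_zero
  exact fderiv_sub h1 h2

end JetCalculus

/-! ### The boosted background as a pull-back of the Kerr–Schild components -/

section Boosted

variable (Λ : lorentzGroup) (c : E4) (M a : ℝ)

/-- The inverse Poincaré map is affine with derivative `Λ⁻¹`. [folklore] -/
theorem hasFDerivAt_poincareInv (y : E4) :
    HasFDerivAt (poincareInv Λ c) ((Λ : E4 ≃L[ℝ] E4).symm : E4 →L[ℝ] E4) y := by
  have h : HasFDerivAt (fun x : E4 ↦ x - c) (ContinuousLinearMap.id ℝ E4) y :=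
    (hasFDerivAt_id y).sub_const c
  have h2 := ((Λ : E4 ≃L[ℝ] E4).symm : E4 →L[ℝ] E4).hasFDerivAt.comp y h
  rw [ContinuousLinearMap.comp_id] at h2
  exact h2

/-- `D(poincareInv Λ c)_y = Λ⁻¹`. [folklore] -/
theorem fderiv_poincareInv (y : E4) :
    fderiv ℝ (poincareInv Λ c) y = ((Λ : E4 ≃L[ℝ] E4).symm : E4 →L[ℝ] E4) :=
  (hasFDerivAt_poincareInv Λ c y).fderiv

/-- The inverse Poincaré map is smooth. [folklore] -/
theorem contDiff_poincareInv {n : WithTop ℕ∞} : ContDiff ℝ n (poincareInv Λ c) := by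
  unfold poincareInv
  exact ((Λ : E4 ≃L[ℝ] E4).symm : E4 →L[ℝ] E4).contDiff.comp (contDiff_id.sub contDiff_const)

/-- **The boosted Kerr–Schild form is the pull-back of the Kerr–Schild components by the inverse
Poincaré map**: `boostedKerrBilin Λ c M a = (poincareInv Λ c)^* (Kerr.bilin M a)` as coordinate
component fields (`MetricCoord.pullMetric`). [cite: KerrSchild1965] -/
theorem boostedKerrBilin_eq_pullMetric :
    boostedKerrBilin Λ c M a = pullMetric (Kerr.bilin M a) (poincareInv Λ c) := by
  funext y
  ext v w
  rw [boostedKerrBilin_apply, pullMetric_apply, fderiv_poincareInv]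
  rfl

/-- The inverse Poincaré map is a change of coordinates from the boosted exterior onto the Kerr
exterior chart domain. [folklore] -/
theorem isCoordChangeOn_poincareInv :
    IsCoordChangeOn (poincareInv Λ c) (boostedKerrExterior Λ c M a : Set E4)
      (Kerr.exterior M a : Set E4) where
  isOpen := (boostedKerrExterior Λ c M a).isOpen
  contDiffOn := (contDiff_poincareInv Λ c).contDiffOn
  mapsTo _ hy := hy
  isInvertible y _ := ⟨(Λ : E4 ≃L[ℝ] E4).symm, (fderiv_poincareInv Λ c y).symm⟩

/-- The boosted Kerr–Schild form is smooth at the points of the boosted exterior. [cite: KerrSchild1965] -/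
theorem contDiffAt_boostedKerrBilin {y : E4} (hy : y ∈ boostedKerrExterior Λ c M a)
    {n : WithTop ℕ∞} : ContDiffAt ℝ n (boostedKerrBilin Λ c M a) y := by
  have hr : 0 < Kerr.radius a (poincareInv Λ c y) := Kerr.radius_pos_of_mem_region hy
  have h1 : ContDiffAt ℝ n (fun x ↦ Kerr.bilin M a (poincareInv Λ c x)) y :=
    (Kerr.contDiffAt_bilin M a hr).comp y (contDiff_poincareInv Λ c).contDiffAt
  have heq : boostedKerrBilin Λ c M a = fun x ↦
      (ContinuousLinearMap.precomp ℝ ((Λ : E4 ≃L[ℝ] E4).symm : E4 →L[ℝ] E4)).comp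
        ((Kerr.bilin M a (poincareInv Λ c x)).comp ((Λ : E4 ≃L[ℝ] E4).symm : E4 →L[ℝ] E4)) := by
    funext x
    rfl
  rw [heq]
  exact contDiffAt_const.clm_comp (h1.clm_comp contDiffAt_const)

/-- **The boosted Kerr–Schild form gives metric components on the boosted exterior.**
[cite: KerrSchild1965] -/
theorem isMetricOn_boostedKerrBilin :
    IsMetricOn (boostedKerrBilin Λ c M a) (boostedKerrExterior Λ c M a : Set E4) := by
  rw [boostedKerrBilin_eq_pullMetric]
  exact (isMetricOn_kerrBilin M a (Kerr.rPlus M a)).isMetricOn_pullMetric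
    (isCoordChangeOn_poincareInv Λ c M a)

end Boosted

/-! ### Invariance of the jets of a component field under a translation symmetry -/

section Translation

variable {E : Type*} [NormedAddCommGroup E] [NormedSpace ℝ E] {G : E → E →L[ℝ] E →L[ℝ] ℝ}
  {v : E}

/-- If `G (x + v) = G x` for all `x`, then `DG (x + v) = DG x` (unconditional chain rule for
translations, `fderiv_comp_add_right`). [folklore] -/
theorem fderiv_eq_of_forall_add_eq {F : Type*} [NormedAddCommGroup F] [NormedSpace ℝ F]
    {f : E → F} (h : ∀ x, f (x + v) = f x) (x : E) : fderiv ℝ f (x + v) = fderiv ℝ f x := by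
  rw [← fderiv_comp_add_right v]
  exact congrArg (fun g : E → F ↦ fderiv ℝ g x) (funext h)

/-- Translation invariance passes to the second derivative. [folklore] -/
theorem fderiv_fderiv_eq_of_forall_add_eq (h : ∀ x, G (x + v) = G x) (x : E) :
    fderiv ℝ (fderiv ℝ G) (x + v) = fderiv ℝ (fderiv ℝ G) x :=
  fderiv_eq_of_forall_add_eq (fderiv_eq_of_forall_add_eq h) x

/-- Translation invariance passes to `♯`. [folklore] -/
theorem sharpAt_eq_of_forall_add_eq (h : ∀ x, G (x + v) = G x) (x : E) :
    sharpAt G (x + v) = sharpAt G x := by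
  show (G (x + v)).inverse = (G x).inverse
  rw [h x]

/-- Translation invariance passes to the Christoffel map. [folklore] -/
theorem chrAt_eq_of_forall_add_eq (h : ∀ x, G (x + v) = G x) (x : E) :
    chrAt G (x + v) = chrAt G x := by
  unfold chrAt koszulCLM
  rw [sharpAt_eq_of_forall_add_eq h, fderiv_eq_of_forall_add_eq h]

/-- Translation invariance passes to the curvature endomorphisms. [folklore] -/
theorem riemAt_eq_of_forall_add_eq (h : ∀ x, G (x + v) = G x) (x X Y : E) :
    riemAt G (x + v) X Y = riemAt G x X Y := by
  unfold riemAt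
  rw [chrAt_eq_of_forall_add_eq h, fderiv_eq_of_forall_add_eq (chrAt_eq_of_forall_add_eq h)]

/-- Translation invariance passes to the inverse metric coefficients. [folklore] -/
theorem ginv_eq_of_forall_add_eq [FiniteDimensional ℝ E] {ι : Type*} (b : Module.Basis ι ℝ E)
    (h : ∀ x, G (x + v) = G x) (x : E) (i j : ι) :
    ginv G b (x + v) i j = ginv G b x i j := by
  unfold ginv
  rw [sharpAt_eq_of_forall_add_eq h]

end Translation

/-! ### The boosted background is stationary along the Killing orbit -/

section Stationary

variable (Λ : lorentzGroup) (c : E4) (M a : ℝ)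

/-- Rest-frame coordinates of the translate `x + s Λe₀`: `Λ⁻¹(x + sΛe₀ − c) = Λ⁻¹(x − c) + s e₀`
(Poincaré maps are affine; O'Neill 1983, Ch. 9, p. 236). [folklore] -/
theorem poincareInv_add_smul (x : E4) (s : ℝ) :
    poincareInv Λ c (x + s • (Λ : E4 ≃L[ℝ] E4) (EuclideanSpace.single (0 : Fin 4) (1 : ℝ))) =
      poincareInv Λ c x + s • E4.basisVector 0 := by
  simp only [poincareInv, E4.basisVector]
  rw [show x + s • (Λ : E4 ≃L[ℝ] E4) (EuclideanSpace.single (0 : Fin 4) (1 : ℝ)) - c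
      = (x - c) + s • (Λ : E4 ≃L[ℝ] E4) (EuclideanSpace.single (0 : Fin 4) (1 : ℝ)) by abel,
    map_add, map_smul, ContinuousLinearEquiv.symm_apply_apply]

/-- Along the Killing orbit the rest-frame time advances by `s`: `t*(x + sΛe₀) = t*(x) + s`.
[folklore] -/
theorem time_add_smul (x : E4) (s : ℝ) :
    (boostedKerrBackground Λ c M a).time
        (x + s • (Λ : E4 ≃L[ℝ] E4) (EuclideanSpace.single (0 : Fin 4) (1 : ℝ))) =
      (boostedKerrBackground Λ c M a).time x + s := by
  show poincareInv Λ c _ 0 = poincareInv Λ c x 0 + s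
  rw [poincareInv_add_smul]
  simp [E4.basisVector]

/-- Along the Killing orbit the rest-frame Kerr–Schild radius is constant
(`Kerr.radius_add_time_smul_basisVector`). [folklore] -/
theorem radius_add_smul (x : E4) (s : ℝ) :
    (boostedKerrBackground Λ c M a).radius
        (x + s • (Λ : E4 ≃L[ℝ] E4) (EuclideanSpace.single (0 : Fin 4) (1 : ℝ))) =
      (boostedKerrBackground Λ c M a).radius x := by
  show Kerr.radius a (poincareInv Λ c _) = Kerr.radius a (poincareInv Λ c x)
  rw [poincareInv_add_smul, Kerr.radius_add_time_smul_basisVector]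

/-- **Stationarity of the boosted Kerr–Schild form along the Killing orbit**:
`g_B(x + sΛe₀) = g_B(x)` (`Kerr.bilin_add_smul_basisVector_zero` transported by the Poincaré map;
Kerr–Schild 1965, §2). [cite: KerrSchild1965, §2] -/
theorem boostedKerrBilin_add_smul (x : E4) (s : ℝ) :
    boostedKerrBilin Λ c M a (x + s • (Λ : E4 ≃L[ℝ] E4) (EuclideanSpace.single (0 : Fin 4) (1 : ℝ))) =
      boostedKerrBilin Λ c M a x := by
  ext v w
  rw [boostedKerrBilin_apply, boostedKerrBilin_apply, poincareInv_add_smul,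
    Kerr.bilin_add_smul_basisVector_zero]

end Stationary

/-! ### The components `Ψ^* g` of a spacetime metric in a chart from the boosted background -/

section ChartMetric

universe u

variable {𝓢 : Spacetime.{u} 4} {U : Opens E4} {Ψ : U → 𝓢.carrier}
  (hΨ : ContMDiff 𝓘(ℝ, E4) (𝓡 4) ∞ Ψ) {Gp : E4 → E4 →L[ℝ] E4 →L[ℝ] ℝ}
  (hGp : ∀ y : U, pullbackBilin (I := 𝓡 4) (I' := 𝓘(ℝ, E4)) Ψ 𝓢.metric.val y = Gp y)

include hΨ hGp in
/-- **The components of `Ψ^* g` are smooth on the chart domain**: the pull-back of the metric is a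
smooth section of the bundle of bilinear forms (`contMDiff_pullbackBilin_holds`), i.e. its
representative is smooth (`OpensChart.contMDiffAt_bilinSection_iff`).
[cite: ONeill1983, Ch. 3, Lemma 3.35] -/
theorem contDiffAt_chartMetric (y : U) : ContDiffAt ℝ ∞ Gp y := by
  have hsec := PseudoRiemannianMetric.contMDiff_pullbackBilin_holds (I := 𝓡 4) (M := 𝓢.carrier)
    (I' := 𝓘(ℝ, E4)) (N := U) (n := ∞) Ψ hΨ 𝓢.metric.toPseudoRiemannianMetric
  exact (OpensChart.contMDiffAt_bilinSection_iff y
    (fun y ↦ pullbackBilin (I := 𝓡 4) (I' := 𝓘(ℝ, E4)) Ψ 𝓢.metric.val y) Gp hGp).1 (hsec y)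

include hGp in
/-- The components of `Ψ^* g` are symmetric. [folklore] -/
theorem chartMetric_symm (y : U) (v w : E4) : Gp y v w = Gp y w v := by
  have e : ∀ v w : E4, Gp y v w = 𝓢.metric.val (Ψ y) (mfderiv 𝓘(ℝ, E4) (𝓡 4) Ψ y v)
      (mfderiv 𝓘(ℝ, E4) (𝓡 4) Ψ y w) := fun v w ↦ by
    rw [← hGp y]
    rfl
  rw [e, e]
  exact 𝓢.metric.symm _ _ _

include hGp in
/-- Unfolding: `(Ψ^* g)_y(v, w) = g_{Ψ y}(dΨ_y v, dΨ_y w)`. [cite: ONeill1983, Ch. 3, Def. 3.9] -/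
theorem chartMetric_apply (y : U) (v w : E4) :
    Gp y v w = 𝓢.metric.val (Ψ y) (mfderiv 𝓘(ℝ, E4) (𝓡 4) Ψ y v)
      (mfderiv 𝓘(ℝ, E4) (𝓡 4) Ψ y w) := by
  rw [← hGp y]
  rfl

include hΨ hGp in
/-- On the open set of points of `U` where `Ψ^* g` is nondegenerate, its components are metric
components. [folklore] -/
theorem isMetricOn_chartMetric {W : Set E4} (hW : IsOpen W) (hWU : W ⊆ (U : Set E4))
    (hinv : ∀ y ∈ W, (Gp y).IsInvertible) : IsMetricOn Gp W where
  isOpen := hW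
  contDiffOn y hy := (contDiffAt_chartMetric hΨ hGp ⟨y, hWU hy⟩).contDiffWithinAt
  symm y hy v w := chartMetric_symm hGp ⟨y, hWU hy⟩ v w
  isInvertible := hinv

end ChartMetric

/-! ### The composite chart `χ ∘ Ψ` into the Kerr–Schild chart and the chain rule -/

section Composite

universe u

variable {𝓢 : Spacetime.{u} 4} {U : Opens E4} {Ψ : U → 𝓢.carrier}
  (hΨ : ContMDiff 𝓘(ℝ, E4) (𝓡 4) ∞ Ψ) {Gp : E4 → E4 →L[ℝ] E4 →L[ℝ] ℝ}
  (hGp : ∀ y : U, pullbackBilin (I := 𝓡 4) (I' := 𝓘(ℝ, E4)) Ψ 𝓢.metric.val y = Gp y)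
  {a₀ r₀ : ℝ} {E : Set 𝓢.carrier} {χ : 𝓢.carrier → Kerr.region a₀ r₀} (hE : IsOpen E)
  (hχ : ContMDiffOn (𝓡 4) (𝓡 4) ∞ χ E)

/-- The Kerr–Schild coordinates of `χ (Ψ y)`, extended by `0` off the chart domain: the
representative `E4 → E4` of the composite chart `χ ∘ Ψ`. [folklore] -/
theorem compChart_apply (y : U) :
    Function.extend Subtype.val (fun y : U ↦ ((χ (Ψ y)).1 : E4)) 0 y = (χ (Ψ y)).1 :=
  Subtype.val_injective.extend_apply _ _ y

include hΨ hχ hE in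
/-- The composite chart `y ↦ χ (Ψ y) ∈ E4` is smooth (as a map on `U`) at the points mapped into
`E`. [folklore] -/
theorem contMDiffAt_compChart {y : U} (hy : Ψ y ∈ E) :
    ContMDiffAt 𝓘(ℝ, E4) 𝓘(ℝ, E4) ∞ (fun y : U ↦ ((χ (Ψ y)).1 : E4)) y := by
  have hval : ContMDiffAt (𝓡 4) 𝓘(ℝ, E4) ∞ (Subtype.val : Kerr.region a₀ r₀ → E4) (χ (Ψ y)) :=
    (contMDiff_subtype_val (I := 𝓘(ℝ, E4)) (n := ∞) (U := Kerr.region a₀ r₀)).contMDiffAt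
  have hχy : ContMDiffAt (𝓡 4) (𝓡 4) ∞ χ (Ψ y) := hχ.contMDiffAt (hE.mem_nhds hy)
  exact (hval.comp _ hχy).comp y (hΨ y)

include hΨ hχ hE in
/-- The representative of the composite chart is smooth at the points of `U` mapped into `E`.
[folklore] -/
theorem contDiffAt_compChart {y : U} (hy : Ψ y ∈ E) :
    ContDiffAt ℝ ∞ (Function.extend Subtype.val (fun y : U ↦ ((χ (Ψ y)).1 : E4)) 0) y :=
  (OpensChart.contMDiffAt_iff y (fun y : U ↦ ((χ (Ψ y)).1 : E4)) _
    (fun z ↦ (compChart_apply z).symm)).1 (contMDiffAt_compChart hΨ hE hχ hy)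

include hΨ hχ hE in
/-- **Chain rule for the composite chart**: `D(χ ∘ Ψ)_y v = dχ_{Ψ y}(dΨ_y v)` in `E4`.
[folklore] -/
theorem fderiv_compChart_apply {y : U} (hy : Ψ y ∈ E) (v : E4) :
    fderiv ℝ (Function.extend Subtype.val (fun y : U ↦ ((χ (Ψ y)).1 : E4)) 0) y v =
      mfderiv (𝓡 4) (𝓡 4) χ (Ψ y) (mfderiv 𝓘(ℝ, E4) (𝓡 4) Ψ y v) := by
  have hdiff := contDiffAt_compChart hΨ hE hχ hy
  rw [← OpensChart.mfderiv_eq y (fun y : U ↦ ((χ (Ψ y)).1 : E4)) _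
    (fun z ↦ (compChart_apply z).symm) (hdiff.differentiableAt (by simp))]
  have hval : MDifferentiableAt (𝓡 4) 𝓘(ℝ, E4) (Subtype.val : Kerr.region a₀ r₀ → E4) (χ (Ψ y)) :=
    (contMDiff_subtype_val (I := 𝓘(ℝ, E4)) (n := ∞) (U := Kerr.region a₀ r₀)).mdifferentiableAt
      (by simp)
  have hχy : MDifferentiableAt (𝓡 4) (𝓡 4) χ (Ψ y) :=
    (hχ.contMDiffAt (hE.mem_nhds hy)).mdifferentiableAt (by simp)
  have hΨy : MDifferentiableAt 𝓘(ℝ, E4) (𝓡 4) Ψ y := (hΨ y).mdifferentiableAt (by simp)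
  have h1 := mfderiv_comp y (hval.comp _ hχy) hΨy
  have h2 := mfderiv_comp (Ψ y) hval hχy
  have hfun : (fun y : U ↦ ((χ (Ψ y)).1 : E4)) = (Subtype.val ∘ χ) ∘ Ψ := rfl
  rw [hfun, h1, h2]
  show mfderiv (𝓡 4) 𝓘(ℝ, E4) Subtype.val (χ (Ψ y))
      (mfderiv (𝓡 4) (𝓡 4) χ (Ψ y) (mfderiv 𝓘(ℝ, E4) (𝓡 4) Ψ y v)) = _
  exact OpensChart.mfderiv_subtypeVal_apply (U := Kerr.region a₀ r₀) (χ (Ψ y)) _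

variable [Kerr.Facts] {M₀ : ℝ} {hM₀ : 0 ≤ M₀}
  (hpull : ∀ p ∈ E, pullbackBilin (I := 𝓡 4) (I' := 𝓡 4)
    (M := (Kerr.spacetime M₀ a₀ r₀ hM₀).carrier) χ
    (Kerr.spacetime M₀ a₀ r₀ hM₀).metric.val p = 𝓢.metric.val p)

include hGp hpull in
/-- **`Ψ^* g = (χ ∘ Ψ)^* g_{M,a}` where `g = χ^* g_{M,a}`**: at a point of `U` mapped into `E` the
components of `Ψ^* g` are `g_{M,a}(χ Ψ y)(dχ dΨ v, dχ dΨ w)`. [cite: ONeill1983, Ch. 3, p. 58] -/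
theorem chartMetric_eq_kerrBilin {y : U} (hy : Ψ y ∈ E) (v w : E4) :
    Gp y v w = Kerr.bilin M₀ a₀ (χ (Ψ y)).1
      (mfderiv (𝓡 4) (𝓡 4) χ (Ψ y) (mfderiv 𝓘(ℝ, E4) (𝓡 4) Ψ y v))
      (mfderiv (𝓡 4) (𝓡 4) χ (Ψ y) (mfderiv 𝓘(ℝ, E4) (𝓡 4) Ψ y w)) := by
  rw [chartMetric_apply hGp y v w, ← hpull (Ψ y) hy]
  rfl

include hΨ hGp hE hχ hpull in
/-- **The components of `Ψ^* g` are the pull-back of the Kerr–Schild components by the composite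
chart**: `Ψ^* g = (χ ∘ Ψ)^* (Kerr.bilin M a)` at the points of `U` mapped into `E`
(`MetricCoord.pullMetric`). [cite: ONeill1983, Ch. 3, p. 58] -/
theorem chartMetric_eq_pullMetric {y : U} (hy : Ψ y ∈ E) :
    Gp y = pullMetric (Kerr.bilin M₀ a₀)
      (Function.extend Subtype.val (fun y : U ↦ ((χ (Ψ y)).1 : E4)) 0) y := by
  ext v w
  rw [pullMetric_apply, compChart_apply, fderiv_compChart_apply hΨ hE hχ hy,
    fderiv_compChart_apply hΨ hE hχ hy, chartMetric_eq_kerrBilin hGp hpull hy]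

include hΨ hGp hE hχ hpull in
/-- Where `Ψ^* g` is nondegenerate, the composite chart has invertible derivative (a pull-back
by a non-injective linear map is degenerate). [folklore] -/
theorem isInvertible_fderiv_compChart {y : U} (hy : Ψ y ∈ E) (hinv : (Gp y).IsInvertible) :
    (fderiv ℝ (Function.extend Subtype.val (fun y : U ↦ ((χ (Ψ y)).1 : E4)) 0) y).IsInvertible := by
  refine isInvertible_of_injective fun v₁ v₂ hv ↦ ?_
  obtain ⟨e, he⟩ := hinv
  have h0 : Gp y (v₁ - v₂) = 0 := by
    ext w
    rw [chartMetric_eq_pullMetric hΨ hGp hE hχ hpull hy, pullMetric_apply, map_sub, hv, sub_self,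
      map_zero, _root_.zero_apply, _root_.zero_apply]
  have : e (v₁ - v₂) = 0 := by
    have h1 : (e : E4 →L[ℝ] E4 →L[ℝ] ℝ) (v₁ - v₂) = Gp y (v₁ - v₂) := by rw [he]
    exact h1.trans h0
  exact sub_eq_zero.mp (e.map_eq_zero_iff.mp this)

omit [Kerr.Facts] in
include hΨ hGp hE in
/-- **The good set** of chart points mapped into `E` at which `Ψ^* g` is nondegenerate is open.
[folklore] -/
theorem isOpen_goodSet :
    IsOpen {z : E4 | ∃ h : z ∈ U, Ψ ⟨z, h⟩ ∈ E ∧ (Gp z).IsInvertible} := by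
  have h1 : IsOpen (Subtype.val '' (Ψ ⁻¹' E) : Set E4) :=
    U.isOpen.isOpenMap_subtype_val _ (hE.preimage hΨ.continuous)
  have hcont : ContinuousOn Gp (U : Set E4) := fun z hz ↦
    (contDiffAt_chartMetric hΨ hGp ⟨z, hz⟩).continuousAt.continuousWithinAt
  have h2 : IsOpen ((U : Set E4) ∩ Gp ⁻¹' range ((↑) : (E4 ≃L[ℝ] E4 →L[ℝ] ℝ) → E4 →L[ℝ] E4 →L[ℝ] ℝ)) :=
    hcont.isOpen_inter_preimage U.isOpen ContinuousLinearEquiv.isOpen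
  have heq : {z : E4 | ∃ h : z ∈ U, Ψ ⟨z, h⟩ ∈ E ∧ (Gp z).IsInvertible} =
      (Subtype.val '' (Ψ ⁻¹' E) : Set E4) ∩
        ((U : Set E4) ∩ Gp ⁻¹' range ((↑) : (E4 ≃L[ℝ] E4 →L[ℝ] ℝ) → E4 →L[ℝ] E4 →L[ℝ] ℝ)) := by
    ext z
    simp only [mem_setOf_eq, mem_inter_iff, mem_image, mem_preimage, mem_range]
    constructor
    · rintro ⟨h, hzE, e, he⟩
      exact ⟨⟨⟨z, h⟩, hzE, rfl⟩, h, e, he⟩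
    · rintro ⟨⟨y, hyE, rfl⟩, h, e, he⟩
      exact ⟨y.2, hyE, e, he⟩
  rw [heq]
  exact h1.inter h2

omit [Kerr.Facts] in
include hΨ hGp hE in
/-- On the good set the components of `Ψ^* g` are metric components. [folklore] -/
theorem isMetricOn_chartMetric_goodSet :
    IsMetricOn Gp {z : E4 | ∃ h : z ∈ U, Ψ ⟨z, h⟩ ∈ E ∧ (Gp z).IsInvertible} :=
  isMetricOn_chartMetric hΨ hGp (isOpen_goodSet hΨ hGp hE) (fun _ hz ↦ hz.1) fun _ hz ↦ hz.2.2

include hΨ hGp hE hχ hpull in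
/-- **The composite chart is a change of coordinates on the good set** into the Kerr–Schild
chart domain. [folklore] -/
theorem isCoordChangeOn_compChart :
    IsCoordChangeOn (Function.extend Subtype.val (fun y : U ↦ ((χ (Ψ y)).1 : E4)) 0)
      {z : E4 | ∃ h : z ∈ U, Ψ ⟨z, h⟩ ∈ E ∧ (Gp z).IsInvertible} (Kerr.region a₀ r₀ : Set E4) where
  isOpen := isOpen_goodSet hΨ hGp hE
  contDiffOn z hz := (contDiffAt_compChart hΨ hE hχ (y := ⟨z, hz.1⟩) hz.2.1).contDiffWithinAt
  mapsTo z hz := by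
    obtain ⟨h, -, -⟩ := hz
    rw [show z = ((⟨z, h⟩ : U) : E4) from rfl, compChart_apply]
    exact (χ (Ψ ⟨z, h⟩)).2
  isInvertible z hz := isInvertible_fderiv_compChart hΨ hGp hE hχ hpull (y := ⟨z, hz.1⟩) hz.2.1 hz.2.2

end Composite

/-! ### The polar near-horizon point of the boosted extremal background -/

section PolarPoint

/-- The rest-frame polar-axis point `(0, 0, 0, r')` of the Kerr–Schild chart. [folklore] -/
theorem polar_apply (r' : ℝ) (μ : Fin 4) :
    (r' • E4.basisVector 3 : E4) μ = if μ = 3 then r' else 0 := by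
  fin_cases μ <;> simp

/-- On the polar axis the Kerr–Schild radius is `|z|`: `r(0,0,0,r') = r'` for `r' ≥ 0`
(Visser arXiv:0706.0622, (35): `r⁴ − (ρ² − a²) r² − a² z² = 0` with `ρ = |z|`). [folklore] -/
theorem radius_polar (a : ℝ) {r' : ℝ} (hr' : 0 ≤ r') :
    Kerr.radius a (r' • E4.basisVector 3) = r' := by
  have hs : E4.spatialNorm (r' • E4.basisVector 3 : E4) ^ 2 = r' ^ 2 := by
    rw [E4.spatialNorm_sq]
    simp
  have h3 : (r' • E4.basisVector 3 : E4) 3 = r' := by simp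
  have hsq := Kerr.radius_sq a (r' • E4.basisVector 3)
  rw [hs, h3, show (r' ^ 2 - a ^ 2) ^ 2 + 4 * a ^ 2 * r' ^ 2 = (r' ^ 2 + a ^ 2) ^ 2 by ring,
    Real.sqrt_sq (by positivity)] at hsq
  have h2 : Kerr.radius a (r' • E4.basisVector 3) ^ 2 = r' ^ 2 := by rw [hsq]; ring
  have hnn := Kerr.radius_nonneg a (r' • E4.basisVector 3)
  nlinarith [sq_nonneg (Kerr.radius a (r' • E4.basisVector 3) - r'),
    sq_nonneg (Kerr.radius a (r' • E4.basisVector 3) + r')]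

/-- On the polar axis `H = M r' / (r'² + a²)` (`H = M r³/(r⁴ + a² z²)` with `z = r = r'`;
Visser arXiv:0706.0622, (33)). [folklore] -/
theorem scalarH_polar (M a : ℝ) {r' : ℝ} (hr' : 0 < r') :
    Kerr.scalarH M a (r' • E4.basisVector 3) = M * r' / (r' ^ 2 + a ^ 2) := by
  unfold Kerr.scalarH
  rw [radius_polar a hr'.le, show (r' • E4.basisVector 3 : E4) 3 = r' by simp]
  have h1 : r' ^ 4 + a ^ 2 * r' ^ 2 = r' ^ 2 * (r' ^ 2 + a ^ 2) := by ring
  rw [h1]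
  have h2 : r' ^ 2 + a ^ 2 ≠ 0 := by positivity
  field_simp

/-- On the polar axis `g(∂_{t*}, ∂_{t*}) = −1 + 2H = −1 + 2 M r'/(r'² + a²)`
(`ℓ(∂_{t*}) = 1`, `η(∂_{t*}, ∂_{t*}) = −1`). [folklore] -/
theorem bilin_polar_basisVector_zero (M a : ℝ) {r' : ℝ} (hr' : 0 < r') :
    Kerr.bilin M a (r' • E4.basisVector 3) (E4.basisVector 0) (E4.basisVector 0) =
      -1 + 2 * (M * r' / (r' ^ 2 + a ^ 2)) := by
  rw [Kerr.bilin_apply, Minkowski.bilin_basisVector_zero, Kerr.nullCovector_basisVector_zero,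
    scalarH_polar M a hr']
  ring

/-- **On the polar axis of an extremal Kerr background, `∂_{t*}` is timelike off the horizon**:
`g(∂_{t*}, ∂_{t*}) = −(r' − M)²/(r'² + M²) < 0` for `|a| = M`, `0 < r' ≠ M`. [folklore] -/
theorem bilin_polar_basisVector_zero_neg {M a r' : ℝ} (ha : |a| = M) (hr' : 0 < r')
    (hne : r' ≠ M) :
    Kerr.bilin M a (r' • E4.basisVector 3) (E4.basisVector 0) (E4.basisVector 0) < 0 := by
  rw [bilin_polar_basisVector_zero M a hr']
  have ha2 : a ^ 2 = M ^ 2 := by rw [← sq_abs, ha]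
  rw [ha2]
  have hpos : 0 < r' ^ 2 + M ^ 2 := by positivity
  have hlt : 2 * (M * r') < r' ^ 2 + M ^ 2 := by
    nlinarith [sq_pos_of_ne_zero (sub_ne_zero.mpr hne)]
  have : 2 * (M * r' / (r' ^ 2 + M ^ 2)) < 1 := by
    rw [← mul_div_assoc, div_lt_one hpos]
    exact hlt
  linarith

/-- For extremal parameters `|a| = M` the two horizon radii coincide with `M`: `r₊ = M`.
[folklore] -/
theorem rPlus_of_abs_eq {M a : ℝ} (ha : |a| = M) : Kerr.rPlus M a = M := by
  have ha2 : a ^ 2 = M ^ 2 := by rw [← sq_abs, ha]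
  simp [Kerr.rPlus, ha2]

/-- The boosted polar point `x₀ = Λ(0,0,0,r') + c` has rest-frame coordinates `(0,0,0,r')`.
[folklore] -/
theorem poincareInv_boostedPolar (Λ : lorentzGroup) (c : E4) (r' : ℝ) :
    poincareInv Λ c ((Λ : E4 ≃L[ℝ] E4) (r' • E4.basisVector 3) + c) = r' • E4.basisVector 3 := by
  simp [poincareInv]

/-- The boosted polar point at rest-frame radius `r' > M'` lies in the boosted extremal exterior
`{r > r₊ = M'}`. [folklore] -/
theorem boostedPolar_mem_domain (Λ : lorentzGroup) (c : E4) {M' a' r' : ℝ}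
    (hext : Kerr.IsExtremal M' a') (hr' : M' < r') :
    (Λ : E4 ≃L[ℝ] E4) (r' • E4.basisVector 3) + c ∈ (boostedKerrBackground Λ c M' a').domain := by
  show _ ∈ boostedKerrExterior Λ c M' a'
  rw [mem_boostedKerrExterior, poincareInv_boostedPolar, Kerr.mem_exterior,
    rPlus_of_abs_eq hext.1, radius_polar a' (hext.2.trans hr').le]
  exact max_lt hr' (hext.2.trans hr')

/-- **First conjunct of the stub**: at the boosted polar point `x₀ = Λ(0,0,0,r') + c`,
`M' < r'`, of a boosted EXTREMAL Kerr background the stationary Killing vector `Λe₀` is timelike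
for the background form: `g_B(x₀)(Λe₀, Λe₀) = g_{M',a'}(0,0,0,r')(e₀, e₀) = −(r' − M')²/(r'² + M'²) < 0`.
[folklore] -/
theorem boostedPolar_bilin_neg (Λ : lorentzGroup) (c : E4) {M' a' r' : ℝ}
    (hext : Kerr.IsExtremal M' a') (hr' : M' < r') :
    (boostedKerrBackground Λ c M' a').bilin ((Λ : E4 ≃L[ℝ] E4) (r' • E4.basisVector 3) + c)
        ((Λ : E4 ≃L[ℝ] E4) (EuclideanSpace.single (0 : Fin 4) (1 : ℝ)))
        ((Λ : E4 ≃L[ℝ] E4) (EuclideanSpace.single (0 : Fin 4) (1 : ℝ))) < 0 := by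
  show boostedKerrBilin Λ c M' a' _ _ _ < 0
  rw [boostedKerrBilin_apply, poincareInv_boostedPolar, ContinuousLinearEquiv.symm_apply_apply]
  exact bilin_polar_basisVector_zero_neg hext.1 (hext.2.trans hr') hr'.ne'

end PolarPoint

/-! ### `C²` control of the deviation along the pushed Killing orbit -/

section OrbitJet

universe u

-- the algebraic and the operator-norm instance paths on `E4 →L[ℝ] E4 →L[ℝ] ℝ` unify slowly
set_option synthInstance.maxHeartbeats 400000 in
set_option maxSynthPendingDepth 3 in
/-- **The `2`-jet of the deviation tends to `0` along the Killing orbit.** For a late chart `Ψ`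
from the boosted Kerr–Schild background `B = (Λ, c, M, a)` whose truncated `Cᵏ` deviation tends to
`0` on every near zone, and a background point `x₀` whose straight Killing orbit `s ↦ x₀ + sΛe₀`
stays in the domain, every derivative `D^m(Ψ^* g − g_B)(x₀ + sΛe₀)`, `m ≤ k`, tends to `0` as
`s → ∞`: the orbit point lies on the truncated slab `{t = t(x₀) + s, r ≤ r(x₀)}` (`time_add_smul`,
`radius_add_smul`), where the `Cᵏ` sup norm dominates the pointwise derivative. DHRT
arXiv:2104.08222, §1. [folklore] -/
theorem tendsto_enorm_iteratedFDeriv_deviationExtend_orbit {𝓢 : Spacetime.{u} 4}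
    (Λ : lorentzGroup) (c : E4) (M a : ℝ)
    (Ψ : (boostedKerrBackground Λ c M a).domain → 𝓢.carrier) {k m : ℕ} (hm : m ≤ k)
    (hdev : ∀ R : ℝ, Tendsto (fun τ => 𝓢.truncDeviationCk
      (boostedKerrBackground Λ c M a) Ψ k R τ) atTop (𝓝 0))
    (x₀ : E4)
    (hdom : ∀ s : ℝ, x₀ + s • (Λ : E4 ≃L[ℝ] E4) (EuclideanSpace.single (0 : Fin 4) (1 : ℝ)) ∈
      (boostedKerrBackground Λ c M a).domain) :
    Tendsto (fun s : ℝ ↦ ‖iteratedFDeriv ℝ m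
        (𝓢.deviationExtend (boostedKerrBackground Λ c M a) Ψ)
        (x₀ + s • (Λ : E4 ≃L[ℝ] E4) (EuclideanSpace.single (0 : Fin 4) (1 : ℝ)))‖ₑ)
      atTop (𝓝 0) := by
  have hslab : ∀ s : ℝ,
      (⟨x₀ + s • (Λ : E4 ≃L[ℝ] E4) (EuclideanSpace.single (0 : Fin 4) (1 : ℝ)), hdom s⟩ :
        (boostedKerrBackground Λ c M a).domain) ∈
        (boostedKerrBackground Λ c M a).truncTimeSlab
          ((boostedKerrBackground Λ c M a).radius x₀)
          ((boostedKerrBackground Λ c M a).time x₀ + s) := fun s ↦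
    ⟨time_add_smul Λ c M a x₀ s, (radius_add_smul Λ c M a x₀ s).le⟩
  have hbound : ∀ s : ℝ, ‖iteratedFDeriv ℝ m
      (𝓢.deviationExtend (boostedKerrBackground Λ c M a) Ψ)
      (x₀ + s • (Λ : E4 ≃L[ℝ] E4) (EuclideanSpace.single (0 : Fin 4) (1 : ℝ)))‖ₑ ≤
      𝓢.truncDeviationCk (boostedKerrBackground Λ c M a) Ψ k
        ((boostedKerrBackground Λ c M a).radius x₀)
        ((boostedKerrBackground Λ c M a).time x₀ + s) := fun s ↦
    enorm_iteratedFDeriv_le_supCkENorm hm (mem_image_of_mem Subtype.val (hslab s))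
      (𝓢.deviationExtend (boostedKerrBackground Λ c M a) Ψ)
  have hlim : Tendsto (fun s : ℝ ↦ 𝓢.truncDeviationCk (boostedKerrBackground Λ c M a) Ψ k
      ((boostedKerrBackground Λ c M a).radius x₀)
      ((boostedKerrBackground Λ c M a).time x₀ + s)) atTop (𝓝 0) :=
    (hdev ((boostedKerrBackground Λ c M a).radius x₀)).comp
      (tendsto_atTop_add_const_left atTop ((boostedKerrBackground Λ c M a).time x₀) tendsto_id)
  exact tendsto_of_tendsto_of_tendsto_of_le_of_le tendsto_const_nhds hlim (fun _ ↦ zero_le)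
    hbound

set_option synthInstance.maxHeartbeats 400000 in
set_option maxSynthPendingDepth 3 in
/-- Normed form of `tendsto_enorm_iteratedFDeriv_deviationExtend_orbit`: the derivatives
`D^m(Ψ^* g − g_B)(x₀ + sΛe₀)`, `m ≤ k`, tend to `0` in operator norm. [folklore] -/
theorem tendsto_iteratedFDeriv_deviationExtend_orbit {𝓢 : Spacetime.{u} 4}
    (Λ : lorentzGroup) (c : E4) (M a : ℝ)
    (Ψ : (boostedKerrBackground Λ c M a).domain → 𝓢.carrier) {k m : ℕ} (hm : m ≤ k)
    (hdev : ∀ R : ℝ, Tendsto (fun τ => 𝓢.truncDeviationCk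
      (boostedKerrBackground Λ c M a) Ψ k R τ) atTop (𝓝 0))
    (x₀ : E4)
    (hdom : ∀ s : ℝ, x₀ + s • (Λ : E4 ≃L[ℝ] E4) (EuclideanSpace.single (0 : Fin 4) (1 : ℝ)) ∈
      (boostedKerrBackground Λ c M a).domain) :
    Tendsto (fun s : ℝ ↦ iteratedFDeriv ℝ m
        (𝓢.deviationExtend (boostedKerrBackground Λ c M a) Ψ)
        (x₀ + s • (Λ : E4 ≃L[ℝ] E4) (EuclideanSpace.single (0 : Fin 4) (1 : ℝ))))
      atTop (𝓝 0) := by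
  have h := tendsto_enorm_iteratedFDeriv_deviationExtend_orbit Λ c M a Ψ hm hdev x₀ hdom
  rw [tendsto_zero_iff_norm_tendsto_zero]
  have h2 := (ENNReal.tendsto_toReal ENNReal.zero_ne_top).comp h
  rw [ENNReal.toReal_zero] at h2
  refine h2.congr fun s ↦ ?_
  simp only [Function.comp_apply, toReal_enorm]

end OrbitJet

/-! ### The chart metric of a late chart from the boosted background along the Killing orbit -/

section OrbitSetup

universe u

variable {𝓢 : Spacetime.{u} 4} (Λ : lorentzGroup) (c : E4) (M a : ℝ)
  (Ψ : (boostedKerrBackground Λ c M a).domain → 𝓢.carrier)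

/-- The components of `Ψ^* g` are `(Ψ^* g − g_B) + g_B`, the extended deviation plus the boosted
Kerr–Schild form. [folklore] -/
theorem chartMetric_repr (y : (boostedKerrBackground Λ c M a).domain) :
    pullbackBilin (I := 𝓡 4) (I' := 𝓘(ℝ, E4)) Ψ 𝓢.metric.val y =
      (fun z ↦ 𝓢.deviationExtend (boostedKerrBackground Λ c M a) Ψ z + boostedKerrBilin Λ c M a z) y := by
  show _ = 𝓢.deviationExtend (boostedKerrBackground Λ c M a) Ψ y + boostedKerrBilin Λ c M a y
  rw [Spacetime.deviationExtend_coe]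
  exact (sub_add_cancel _ _).symm

variable {Λ c M a Ψ}

set_option synthInstance.maxHeartbeats 400000 in
set_option maxHeartbeats 1600000 in
/-- **The `2`-jets of the deviation `Ψ^* g − g_B` along the Killing orbit tend to `0`**: values,
and operator norms of the first and second derivatives. [folklore] -/
theorem tendsto_dev_jets_orbit
    (hdev : ∀ R : ℝ, Tendsto (fun τ => 𝓢.truncDeviationCk
      (boostedKerrBackground Λ c M a) Ψ 2 R τ) atTop (𝓝 0))
    (x₀ : E4)
    (hdom : ∀ s : ℝ, x₀ + s • (Λ : E4 ≃L[ℝ] E4) (EuclideanSpace.single (0 : Fin 4) (1 : ℝ)) ∈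
      (boostedKerrBackground Λ c M a).domain) :
    Tendsto (fun s : ℝ ↦ 𝓢.deviationExtend (boostedKerrBackground Λ c M a) Ψ
        (x₀ + s • (Λ : E4 ≃L[ℝ] E4) (EuclideanSpace.single (0 : Fin 4) (1 : ℝ)))) atTop (𝓝 0) ∧
    Tendsto (fun s : ℝ ↦ ‖fderiv ℝ (𝓢.deviationExtend (boostedKerrBackground Λ c M a) Ψ)
        (x₀ + s • (Λ : E4 ≃L[ℝ] E4) (EuclideanSpace.single (0 : Fin 4) (1 : ℝ)))‖) atTop (𝓝 0) ∧
    Tendsto (fun s : ℝ ↦ ‖fderiv ℝ (fderiv ℝ (𝓢.deviationExtend (boostedKerrBackground Λ c M a) Ψ))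
        (x₀ + s • (Λ : E4 ≃L[ℝ] E4) (EuclideanSpace.single (0 : Fin 4) (1 : ℝ)))‖) atTop (𝓝 0) := by
  have h0 := tendsto_iteratedFDeriv_deviationExtend_orbit Λ c M a Ψ (m := 0) (k := 2) (by norm_num)
    hdev x₀ hdom
  have h1 := tendsto_iteratedFDeriv_deviationExtend_orbit Λ c M a Ψ (m := 1) (k := 2) (by norm_num)
    hdev x₀ hdom
  have h2 := tendsto_iteratedFDeriv_deviationExtend_orbit Λ c M a Ψ (m := 2) (k := 2) le_rfl
    hdev x₀ hdom
  refine ⟨?_, ?_, ?_⟩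
  · rw [tendsto_zero_iff_norm_tendsto_zero]
    refine (tendsto_zero_iff_norm_tendsto_zero.mp h0).congr fun s ↦ ?_
    exact norm_iteratedFDeriv_zero
  · refine (tendsto_zero_iff_norm_tendsto_zero.mp h1).congr fun s ↦ ?_
    -- `‖D¹f‖ = ‖Df‖`
    rw [← norm_iteratedFDeriv_fderiv (n := 0), norm_iteratedFDeriv_zero]
  · refine (tendsto_zero_iff_norm_tendsto_zero.mp h2).congr fun s ↦ ?_
    -- `‖D²f‖ = ‖D(Df)‖`
    rw [← norm_iteratedFDeriv_fderiv (n := 1), ← norm_iteratedFDeriv_fderiv (n := 0),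
      norm_iteratedFDeriv_zero]

set_option synthInstance.maxHeartbeats 400000 in
set_option maxHeartbeats 1600000 in
/-- **Jets of `Ψ^* g − g_B` are jets of the deviation**: at a point of the domain the value, the
first and the second derivative of `(Ψ^* g − g_B) + g_B` minus those of `g_B` are those of the
deviation. [folklore] -/
theorem jets_chartMetric_sub (hΨ : ContMDiff 𝓘(ℝ, E4) (𝓡 4) ∞ Ψ) {z : E4}
    (hz : z ∈ (boostedKerrBackground Λ c M a).domain) :
    (fun z ↦ 𝓢.deviationExtend (boostedKerrBackground Λ c M a) Ψ z + boostedKerrBilin Λ c M a z) z -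
        boostedKerrBilin Λ c M a z = 𝓢.deviationExtend (boostedKerrBackground Λ c M a) Ψ z ∧
    fderiv ℝ (fun z ↦ 𝓢.deviationExtend (boostedKerrBackground Λ c M a) Ψ z +
        boostedKerrBilin Λ c M a z) z - fderiv ℝ (boostedKerrBilin Λ c M a) z =
      fderiv ℝ (𝓢.deviationExtend (boostedKerrBackground Λ c M a) Ψ) z ∧
    fderiv ℝ (fderiv ℝ (fun z ↦ 𝓢.deviationExtend (boostedKerrBackground Λ c M a) Ψ z +
        boostedKerrBilin Λ c M a z)) z - fderiv ℝ (fderiv ℝ (boostedKerrBilin Λ c M a)) z =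
      fderiv ℝ (fderiv ℝ (𝓢.deviationExtend (boostedKerrBackground Λ c M a) Ψ)) z := by
  have hGp : ∀ y : (boostedKerrBackground Λ c M a).domain,
      pullbackBilin (I := 𝓡 4) (I' := 𝓘(ℝ, E4)) Ψ 𝓢.metric.val y =
      (fun z ↦ 𝓢.deviationExtend (boostedKerrBackground Λ c M a) Ψ z + boostedKerrBilin Λ c M a z) y :=
    chartMetric_repr Λ c M a Ψ
  have hsmooth : ∀ z ∈ ((boostedKerrBackground Λ c M a).domain : Set E4), ContDiffAt ℝ ∞
      (fun z ↦ 𝓢.deviationExtend (boostedKerrBackground Λ c M a) Ψ z + boostedKerrBilin Λ c M a z) z :=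
    fun z hz ↦ contDiffAt_chartMetric hΨ hGp ⟨z, hz⟩
  have hGBs : ∀ z ∈ ((boostedKerrBackground Λ c M a).domain : Set E4),
      ContDiffAt ℝ ∞ (boostedKerrBilin Λ c M a) z := fun z hz ↦
    contDiffAt_boostedKerrBilin Λ c M a hz
  have hfun : (fun y ↦ (fun z ↦ 𝓢.deviationExtend (boostedKerrBackground Λ c M a) Ψ z +
      boostedKerrBilin Λ c M a z) y - boostedKerrBilin Λ c M a y) =
      𝓢.deviationExtend (boostedKerrBackground Λ c M a) Ψ := by
    funext y
    exact add_sub_cancel_right _ _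
  have hdevs : ContDiffAt ℝ ∞ (𝓢.deviationExtend (boostedKerrBackground Λ c M a) Ψ) z := by
    rw [← hfun]
    exact (hsmooth z hz).sub (hGBs z hz)
  refine ⟨add_sub_cancel_right _ _, ?_, ?_⟩
  · have h := fderiv_add (hdevs.differentiableAt (by simp)) ((hGBs z hz).differentiableAt (by simp))
    rw [show (fun y ↦ 𝓢.deviationExtend (boostedKerrBackground Λ c M a) Ψ y +
        boostedKerrBilin Λ c M a y) = 𝓢.deviationExtend (boostedKerrBackground Λ c M a) Ψ +
        boostedKerrBilin Λ c M a from rfl, h]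
    exact add_sub_cancel_right _ _
  · have hsub := fderiv_fderiv_sub_of_isOpen ((boostedKerrBackground Λ c M a).domain).isOpen hsmooth
      hGBs hz
    rw [hfun] at hsub
    rw [hsub]

/-- **Along the Killing orbit `Ψ^* g` is eventually nondegenerate** (its values tend to the
invertible form `g_B(x₀)`; invertibility is an open condition). [folklore] -/
theorem eventually_isInvertible_orbit
    (hdev : ∀ R : ℝ, Tendsto (fun τ => 𝓢.truncDeviationCk
      (boostedKerrBackground Λ c M a) Ψ 2 R τ) atTop (𝓝 0))
    {x₀ : E4} (hx₀ : x₀ ∈ (boostedKerrBackground Λ c M a).domain)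
    (hdom : ∀ s : ℝ, x₀ + s • (Λ : E4 ≃L[ℝ] E4) (EuclideanSpace.single (0 : Fin 4) (1 : ℝ)) ∈
      (boostedKerrBackground Λ c M a).domain) :
    ∃ s₁ : ℝ, ∀ s : ℝ, s₁ ≤ s →
      ((fun z ↦ 𝓢.deviationExtend (boostedKerrBackground Λ c M a) Ψ z + boostedKerrBilin Λ c M a z)
        (x₀ + s • (Λ : E4 ≃L[ℝ] E4) (EuclideanSpace.single (0 : Fin 4) (1 : ℝ)))).IsInvertible := by
  obtain ⟨h0, -, -⟩ := tendsto_dev_jets_orbit (𝓢 := 𝓢) (Ψ := Ψ) hdev x₀ hdom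
  have hstat : ∀ s : ℝ, boostedKerrBilin Λ c M a
      (x₀ + s • (Λ : E4 ≃L[ℝ] E4) (EuclideanSpace.single (0 : Fin 4) (1 : ℝ))) =
      boostedKerrBilin Λ c M a x₀ :=
    fun s ↦ boostedKerrBilin_add_smul Λ c M a x₀ s
  have hlim : Tendsto (fun s : ℝ ↦ (fun z ↦ 𝓢.deviationExtend (boostedKerrBackground Λ c M a) Ψ z +
      boostedKerrBilin Λ c M a z)
      (x₀ + s • (Λ : E4 ≃L[ℝ] E4) (EuclideanSpace.single (0 : Fin 4) (1 : ℝ)))) atTop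
      (𝓝 (boostedKerrBilin Λ c M a x₀)) := by
    have h := h0.add_const (boostedKerrBilin Λ c M a x₀)
    rw [zero_add] at h
    refine h.congr fun s ↦ ?_
    simp only [hstat s]
  obtain ⟨e, he⟩ := (isMetricOn_boostedKerrBilin Λ c M a).isInvertible x₀ hx₀
  have hmem : ∀ᶠ s : ℝ in atTop, (fun z ↦ 𝓢.deviationExtend (boostedKerrBackground Λ c M a) Ψ z +
      boostedKerrBilin Λ c M a z)
      (x₀ + s • (Λ : E4 ≃L[ℝ] E4) (EuclideanSpace.single (0 : Fin 4) (1 : ℝ))) ∈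
        range ((↑) : (E4 ≃L[ℝ] E4 →L[ℝ] ℝ) → E4 →L[ℝ] E4 →L[ℝ] ℝ) :=
    hlim.eventually (ContinuousLinearEquiv.isOpen.mem_nhds ⟨e, he⟩)
  obtain ⟨s₁, hs₁⟩ := Filter.eventually_atTop.mp hmem
  exact ⟨s₁, fun s hs ↦ hs₁ s hs⟩

end OrbitSetup


end KerrSchildChart

end Literature.Geometry.Lorentzian

end
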